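/-
Copyright (c) 2026 the pub-hodgecm-mathlib formalisation cell (harness21).  Prover seat hodgecm-mathlib-F0P3a-p02 (g18): road «S3-ram», (Cnt2′) ROUTE B (chair
F0P3a-p07 (g15) RULING (13)(5), (14)(1)(2)): the FINITE half of the type-(2) root collar census, I — character sums over the root plane; 2026-09-02.
-/
import Literature.FieldTheory.FiniteFields.ConicCharacterSumTransfer   -- ★ p849208 (this seat): `quadraticChar_quartic_transfer`, `card_filter_sq_eq`; brings ★ `JacobsthalSums`
import HarnessLib

/-!
# The type-(2) root census, I: quadratic-character sums over the residual ROOT PLANE of a traceless self-adjoint block (Rogawski 1990 §4.9; Kottwitz 1986 §3;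
# Lidl–Niederreiter Ch. 5 §4, Ch. 6 §2)

Topic `NumberTheory/Rogawski1990`; namespace `Literature.NumberTheory.Rogawski1990.TypeTwoBlockRoot`.  THEOREMS ONLY (no definition, no instance, no notation, no named
fact, no `sorry`); kernel lane `--supports stmt-HodgeConjecture-24833` (cell `pub/hodgecm-mathlib`, crux H413, road «S3-ram», count-neutral).  Statement-first
`F0/P3a/F0P3a-p02/g18/census/BlockRootCensus.statementfirst.v1.F0P3ap02g18.lean`; blueprint CENSUS NOTE v3 (same directory), STEPS 1–4.

THE MATHEMATICS (`k` finite, odd characteristic, `χ` the quadratic character).  At the root of a type-(2) literal the residual Gram form is, in an orthogonal eigenframe,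
`δ₀w₀² + n(w₁,w₂)` with the ROOT-PLANE norm `n(X,Y) = δ₁X² + δ₂Y²`, and the residual value matrix is a scalar `b₀` at the isolated index plus a `{j,l}`-block
`b₀·1 + C` with `C = ((a, b), (b', −a))` TRACELESS and `n`-SELF-ADJOINT (`δ₁b = δ₂b'`); on the isotropic cone the line value is the binary form
`S(X,Y) = δ₁aX² + 2δ₁bXY − δ₂aY²`, and `e := −det C = a² + bb'` is a NON-SQUARE (irreducible residual characteristic polynomial).  Every census at the root is a sum over
the plane vectors `w ≠ 0` weighted by the cone fibre `1 + χ(−δ₀⁻¹n(w))` (file II).  THIS FILE evaluates the five plane sums that occur: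
* §1 `sum_filter_ne_zero_eq_lines`: a line-invariant `F` has `Σ_{w ≠ 0} F(w) = (q − 1)·(F(1,0) + Σ_x F(x,1))`; small character bookkeeping.
* §2 `sum_ite_value_eq_zero`: the `S`-ISOTROPIC vectors: `Σ_{w ≠ 0, S(w) = 0} G(w) = (q − 1)·(G(1,0) + G(0,1))` if `a = 0`, and `= (q − 1)·Σ_{u² = Δ} G(u − δ₁b, δ₁a)`,
  `Δ = δ₁²b² + δ₁δ₂a² = δ₁δ₂e`, if `a ≠ 0` (completing the square `(δ₁(ax + b))² − Δ = δ₁a·S(x,1)`); hence (I1) `#{w ≠ 0 : S(w) = 0} = (q − 1)(1 − χ(δ₁δ₂))` and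
  (I2) `Σ_{w ≠ 0, S(w) = 0} χ(m·n(w)) = 0` — the two `S`-isotropic lines, when they exist, have `n`-values of OPPOSITE character (`n₊n₋ = e·□`).
* §3 (I3) `Σ_{w ≠ 0} χ(m·n(w)) = 0`, (I4) `Σ_{w ≠ 0} χ(c₀·S(w)) = 0` (Lidl–Niederreiter Thm. 5.48: `Σ_x χ(x² − t) = −1`), and THE JACOBSTHAL TERM
  (I5) `Σ_{w ≠ 0} χ(c₀S(w))·χ(−δ₀⁻¹n(w)) = (q − 1)·χ(c₀δ₀δ₁δ₂)·J(e)`, `J(e) = Σ_x χ(x)χ(x² − e)`, by the quartic-to-cubic transfer ★ `ConicTransfer.quadraticChar_quartic_transfer`.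
HONEST LABEL: HC_CM is proved only modulo the 2 remaining named inputs (hLiu418 24832, h413 24833) until rung 0 closes; finite-field algebra only, nothing printed is asserted.

## References
* [Rogawski1990] J. D. Rogawski, *Automorphic Representations of Unitary Groups in Three Variables*, Ann. of Math. Stud. 123 (1990), §4.9 Prop. 4.9.1 p. 55.
* [Kottwitz1986] R. E. Kottwitz, *Base change for unit elements of Hecke algebras*, Compositio Math. 60 (1986), §3 (counting fixed lattices by residual data).
* [LidlNiederreiter1996] R. Lidl, H. Niederreiter, *Finite Fields*, 2nd ed. (1996), Thm. 5.48, Def. 5.49 (Jacobsthal sums), Thm. 6.26–6.27.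
* [IrelandRosen1990] K. Ireland, M. Rosen, *A Classical Introduction to Modern Number Theory*, GTM 84, Ch. 8 §1–§3.
-/

set_option autoImplicit false

namespace Literature.NumberTheory.Rogawski1990.TypeTwoBlockRoot

open Finset
open Literature.FieldTheory.FiniteFields.ConicTransfer Literature.FieldTheory.FiniteFields.JacobsthalSums

variable {k : Type*} [Field k] [Fintype k] [DecidableEq k]

/-! ## §1 Lines of the plane and character bookkeeping -/

/-- `#{t ∈ k : t ≠ 0} = q − 1` (as an integer). [cite: IrelandRosen1990, Ch. 8 §1] -/
theorem card_filter_ne_zero_eq : ((univ.filter fun t : k => t ≠ 0).card : ℤ) = Fintype.card k - 1 := by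
  rw [Finset.filter_ne' univ (0 : k), Finset.card_erase_of_mem (Finset.mem_univ _), Finset.card_univ, Nat.cast_sub Fintype.card_pos, Nat.cast_one]

/-- **LINES OF THE PLANE.**  If `F : k × k → ℤ` is constant on punctured lines (`F(t·w) = F(w)` for `t ≠ 0`), then
`Σ_{w ≠ 0} F(w) = (q − 1)·(F(1,0) + Σ_x F(x,1))`: the punctured plane is the disjoint union of the punctured lines through `(1,0)` and `(x,1)`, `x ∈ k`.
[cite: LidlNiederreiter1996, Ch. 6 §2] [cite: IrelandRosen1990, Ch. 8 §1] -/
theorem sum_filter_ne_zero_eq_lines (F : k × k → ℤ) (hF : ∀ (t : k) (w : k × k), t ≠ 0 → F (t * w.1, t * w.2) = F w) :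
    ∑ w ∈ univ.filter (fun w : k × k => w ≠ 0), F w = (Fintype.card k - 1) * (F (1, 0) + ∑ x : k, F (x, 1)) := by
  rw [← Finset.sum_filter_add_sum_filter_not (univ.filter fun w : k × k => w ≠ 0) (fun w => w.2 = 0), Finset.filter_filter, Finset.filter_filter]
  -- the punctured line through `(1,0)`
  have hA : ∑ w ∈ univ.filter (fun w : k × k => w ≠ 0 ∧ w.2 = 0), F w = ∑ t ∈ univ.filter (fun t : k => t ≠ 0), F (1, 0) := by
    refine (Finset.sum_bij (fun t _ => ((t, 0) : k × k)) (fun t ht => ?_) (fun t₁ _ t₂ _ h => (Prod.ext_iff.1 h).1) (fun w hw => ?_) (fun t ht => ?_)).symm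
    · rw [Finset.mem_filter] at ht ⊢
      exact ⟨Finset.mem_univ _, fun h => ht.2 (Prod.ext_iff.1 h).1, rfl⟩
    · rw [Finset.mem_filter] at hw
      refine ⟨w.1, ?_, Prod.ext rfl hw.2.2.symm⟩
      rw [Finset.mem_filter]
      exact ⟨Finset.mem_univ _, fun h => hw.2.1 (Prod.ext h hw.2.2)⟩
    · rw [Finset.mem_filter] at ht
      have h := hF t (1, 0) ht.2
      simp only [mul_one, mul_zero] at h
      exact h.symm
  -- the punctured lines through `(x,1)`: `(x,t) ↦ (tx, t)`
  have hB : ∑ w ∈ univ.filter (fun w : k × k => w ≠ 0 ∧ ¬ w.2 = 0), F w = ∑ p ∈ univ.filter (fun p : k × k => p.2 ≠ 0), F (p.1, 1) := by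
    refine (Finset.sum_bij (fun p _ => ((p.2 * p.1, p.2) : k × k)) (fun p hp => ?_) (fun p₁ _ p₂ hp₂ h => ?_) (fun w hw => ?_) (fun p hp => ?_)).symm
    · rw [Finset.mem_filter] at hp ⊢
      exact ⟨Finset.mem_univ _, fun h => hp.2 (Prod.ext_iff.1 h).2, hp.2⟩
    · rw [Finset.mem_filter] at hp₂
      obtain ⟨h1, h2⟩ := Prod.ext_iff.1 h
      simp only at h1 h2
      rw [h2] at h1
      exact Prod.ext (mul_left_cancel₀ hp₂.2 h1) h2
    · rw [Finset.mem_filter] at hw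
      refine ⟨(w.1 / w.2, w.2), ?_, Prod.ext ?_ rfl⟩
      · rw [Finset.mem_filter]; exact ⟨Finset.mem_univ _, hw.2.2⟩
      · show w.2 * (w.1 / w.2) = w.1
        rw [mul_comm]; exact div_mul_cancel₀ _ hw.2.2
    · rw [Finset.mem_filter] at hp
      have h := hF p.2 (p.1, 1) hp.2
      simp only [mul_one] at h
      exact h.symm
  have hB' : ∑ p ∈ univ.filter (fun p : k × k => p.2 ≠ 0), F (p.1, 1) = ∑ x : k, ((univ.filter fun t : k => t ≠ 0).card : ℤ) * F (x, 1) := by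
    rw [Finset.sum_filter, Fintype.sum_prod_type]
    dsimp only
    refine Finset.sum_congr rfl fun x _ => ?_
    rw [Finset.sum_ite, Finset.sum_const_zero, add_zero, Finset.sum_const, nsmul_eq_mul]
  rw [hA, hB, hB', Finset.sum_const, nsmul_eq_mul, ← Finset.mul_sum, card_filter_ne_zero_eq]
  ring

/-- `2·[χ(v) = ε]·t = (χ(v)² + ε·χ(v))·t` for `ε = ±1` — the class indicator as a character polynomial. [cite: IrelandRosen1990, Ch. 8 §1] -/
theorem two_mul_ite_quadraticChar_eq (v : k) (t : ℤ) {ε : ℤ} (hε : ε = 1 ∨ ε = -1) :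
    2 * (if quadraticChar k v = ε then t else 0) = (quadraticChar k v ^ 2 + ε * quadraticChar k v) * t := by
  by_cases hv : v = 0
  · rw [hv, MulChar.map_zero]
    rcases hε with rfl | rfl <;> simp
  · rcases hε with rfl | rfl <;> rcases quadraticChar_dichotomy hv with h | h <;> simp [h]

/-- Values of opposite character cancel: `χ(x)·χ(y) = −1 ⟹ χ(x) + χ(y) = 0`. [cite: IrelandRosen1990, Ch. 8 §1] -/
theorem quadraticChar_add_eq_zero_of_mul_eq_neg_one {x y : k} (h : quadraticChar k x * quadraticChar k y = -1) :
    quadraticChar k x + quadraticChar k y = 0 := by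
  have hx : x ≠ 0 := fun h0 => by rw [h0, MulChar.map_zero, zero_mul] at h; exact absurd h (by decide)
  have hy : y ≠ 0 := fun h0 => by rw [h0, MulChar.map_zero, mul_zero] at h; exact absurd h (by decide)
  have key : ∀ a b : ℤ, (a = 1 ∨ a = -1) → (b = 1 ∨ b = -1) → a * b = -1 → a + b = 0 := by
    rintro a b (rfl | rfl) (rfl | rfl) h <;> omega
  exact key _ _ (quadraticChar_dichotomy hx) (quadraticChar_dichotomy hy) h

/-- The square roots of a non-zero square: `{u : u² = r²} = {r, −r}`, two DISTINCT elements in odd characteristic. [cite: IrelandRosen1990, Ch. 8 §1] -/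
theorem filter_sq_eq_sq (r : k) : (univ.filter fun u : k => u ^ 2 = r ^ 2) = {r, -r} := by
  ext u
  simp only [Finset.mem_filter, Finset.mem_univ, true_and, Finset.mem_insert, Finset.mem_singleton]
  exact sq_eq_sq_iff_eq_or_eq_neg

omit [Fintype k] [DecidableEq k] in
/-- `r ≠ −r` for `r ≠ 0` in odd characteristic. [cite: IrelandRosen1990, Ch. 8 §1] -/
theorem ne_neg_self_of_ne_zero (hk : ringChar k ≠ 2) {r : k} (hr : r ≠ 0) : r ≠ -r := by
  intro h
  have h2 : (2 : k) * r = 0 := by linear_combination h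
  rcases mul_eq_zero.1 h2 with h' | h'
  · exact Ring.two_ne_zero hk h'
  · exact hr h'

/-- A non-square has no square roots: `χ(D) = −1 ⟹ {u : u² = D} = ∅`. [cite: IrelandRosen1990, Ch. 8 §1] -/
theorem filter_sq_eq_empty_of_quadraticChar_eq_neg_one {D : k} (hD : quadraticChar k D = -1) : (univ.filter fun u : k => u ^ 2 = D) = ∅ := by
  rw [Finset.filter_eq_empty_iff]
  intro u _ hu
  rw [← hu] at hD
  by_cases h0 : u = 0
  · rw [h0, zero_pow two_ne_zero, MulChar.map_zero] at hD; exact absurd hD (by decide)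
  · rw [quadraticChar_sq_one' h0] at hD; exact absurd hD (by decide)

/-! ## §2 The `S`-isotropic vectors of the root plane -/

omit [Fintype k] [DecidableEq k] in
/-- The cone value `S(X,Y) = δ₁aX² + 2δ₁bXY − δ₂aY²` is a binary QUADRATIC form: `S(t·w) = t²·S(w)`. [cite: LidlNiederreiter1996, Ch. 6 §2] -/
theorem value_smul (δ₁ δ₂ a b t : k) (w : k × k) :
    δ₁ * a * (t * w.1) ^ 2 + 2 * δ₁ * b * (t * w.1) * (t * w.2) - δ₂ * a * (t * w.2) ^ 2 =
      t ^ 2 * (δ₁ * a * w.1 ^ 2 + 2 * δ₁ * b * w.1 * w.2 - δ₂ * a * w.2 ^ 2) := by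
  ring

omit [Fintype k] [DecidableEq k] in
/-- The root-plane norm `n(X,Y) = δ₁X² + δ₂Y²` is a binary quadratic form: `n(t·w) = t²·n(w)`. [cite: LidlNiederreiter1996, Ch. 6 §2] -/
theorem norm_smul (δ₁ δ₂ t : k) (w : k × k) : δ₁ * (t * w.1) ^ 2 + δ₂ * (t * w.2) ^ 2 = t ^ 2 * (δ₁ * w.1 ^ 2 + δ₂ * w.2 ^ 2) := by
  ring

/-- `χ(c·(t²·v)) = χ(c·v)` for `t ≠ 0` — characters of quadratic-form values are constant on punctured lines. [cite: IrelandRosen1990, Ch. 8 §1] -/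
theorem quadraticChar_mul_sq_mul (c v : k) {t : k} (ht : t ≠ 0) : quadraticChar k (c * (t ^ 2 * v)) = quadraticChar k (c * v) := by
  rw [show c * (t ^ 2 * v) = c * v * t ^ 2 by ring, map_mul, quadraticChar_sq_one' ht, mul_one]

omit [Fintype k] [DecidableEq k] in
/-- An affine map `x ↦ cx + d`, `c ≠ 0`, is a bijection of `k` (substitution in character sums). [cite: LidlNiederreiter1996, Thm. 5.48 (proof)] -/
theorem affine_bijective {c : k} (hc : c ≠ 0) (d : k) : Function.Bijective fun x : k => c * x + d := by
  refine ⟨fun x₁ x₂ h => mul_left_cancel₀ hc (add_right_cancel h), fun u => ⟨(u - d) / c, ?_⟩⟩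
  show c * ((u - d) / c) + d = u
  rw [mul_comm c, div_mul_cancel₀ _ hc]
  ring

/-- IRREDUCIBILITY BOOKKEEPING: `e = a² + bb' ≠ 0`; if `a = 0` then `b ≠ 0` and `χ(δ₁δ₂) = −1`; and `Δ := δ₁²b² + δ₁δ₂a² = δ₁δ₂·e`, so `χ(Δ) = −χ(δ₁δ₂)` and `Δ ≠ 0`
(`δ₁b = δ₂b'`, `χ(e) = −1`). [cite: Rogawski1990, §4.9 Prop. 4.9.1 p. 55] [cite: IrelandRosen1990, Ch. 8 §1] -/
theorem irreducible_bookkeeping {δ₁ δ₂ : k} (hδ₁ : δ₁ ≠ 0) (hδ₂ : δ₂ ≠ 0) {a b b' : k} (hbb : δ₁ * b = δ₂ * b')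
    (hirr : quadraticChar k (a ^ 2 + b * b') = -1) :
    a ^ 2 + b * b' ≠ 0 ∧ (a = 0 → b ≠ 0 ∧ quadraticChar k (δ₁ * δ₂) = -1) ∧
      δ₁ ^ 2 * b ^ 2 + δ₁ * δ₂ * a ^ 2 = δ₁ * δ₂ * (a ^ 2 + b * b') ∧ quadraticChar k (δ₁ ^ 2 * b ^ 2 + δ₁ * δ₂ * a ^ 2) = -quadraticChar k (δ₁ * δ₂) ∧
      δ₁ ^ 2 * b ^ 2 + δ₁ * δ₂ * a ^ 2 ≠ 0 := by
  have he : a ^ 2 + b * b' ≠ 0 := fun h => by rw [h, MulChar.map_zero] at hirr; exact absurd hirr (by decide)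
  have hΔ : δ₁ ^ 2 * b ^ 2 + δ₁ * δ₂ * a ^ 2 = δ₁ * δ₂ * (a ^ 2 + b * b') := by linear_combination (δ₁ * b) * hbb
  refine ⟨he, fun ha => ?_, hΔ, by rw [hΔ, map_mul, hirr, mul_neg, mul_one], by rw [hΔ]; exact mul_ne_zero (mul_ne_zero hδ₁ hδ₂) he⟩
  rw [ha, zero_pow two_ne_zero, zero_add] at hirr he
  have hb : b ≠ 0 := left_ne_zero_of_mul he
  refine ⟨hb, ?_⟩
  have h1 : b * b' * δ₂ ^ 2 = δ₁ * δ₂ * b ^ 2 := by linear_combination (-(δ₂ * b)) * hbb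
  have h2 := congrArg (quadraticChar k) h1
  rw [map_mul, map_mul (quadraticChar k) (δ₁ * δ₂), quadraticChar_sq_one' hδ₂, quadraticChar_sq_one' hb, mul_one, mul_one, hirr] at h2
  exact h2.symm

/-- **THE `S`-ISOTROPIC VECTORS.**  For `G` constant on punctured lines: `Σ_{w ≠ 0} [S(w) = 0]·G(w) = (q − 1)·(G(1,0) + G(0,1))` if `a = 0` (then `S = 2δ₁bXY`, `b ≠ 0`),
and `= (q − 1)·Σ_{u : u² = Δ} G(u − δ₁b, δ₁a)` if `a ≠ 0`, `Δ = δ₁²b² + δ₁δ₂a²` — completing the square `(δ₁(ax + b))² − Δ = δ₁a·S(x,1)` on the lines `(x,1)`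
(the line `(1,0)` has `S = δ₁a ≠ 0`). [cite: LidlNiederreiter1996, Thm. 6.26–6.27] [cite: Kottwitz1986, §3] -/
theorem sum_ite_value_eq_zero (hk : ringChar k ≠ 2) {δ₁ : k} (hδ₁ : δ₁ ≠ 0) (δ₂ : k) {a b : k} (hab : a ≠ 0 ∨ b ≠ 0)
    (G : k × k → ℤ) (hG : ∀ (t : k) (w : k × k), t ≠ 0 → G (t * w.1, t * w.2) = G w) :
    ∑ w ∈ univ.filter (fun w : k × k => w ≠ 0), (if δ₁ * a * w.1 ^ 2 + 2 * δ₁ * b * w.1 * w.2 - δ₂ * a * w.2 ^ 2 = 0 then G w else 0) =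
      (Fintype.card k - 1) * (if a = 0 then G (1, 0) + G (0, 1) else
        ∑ u ∈ univ.filter (fun u : k => u ^ 2 = δ₁ ^ 2 * b ^ 2 + δ₁ * δ₂ * a ^ 2), G (u - δ₁ * b, δ₁ * a)) := by
  have hinv : ∀ (t : k) (w : k × k), t ≠ 0 →
      (fun w : k × k => if δ₁ * a * w.1 ^ 2 + 2 * δ₁ * b * w.1 * w.2 - δ₂ * a * w.2 ^ 2 = 0 then G w else 0) (t * w.1, t * w.2) =
        (fun w : k × k => if δ₁ * a * w.1 ^ 2 + 2 * δ₁ * b * w.1 * w.2 - δ₂ * a * w.2 ^ 2 = 0 then G w else 0) w := by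
    intro t w ht
    have ht2 : t ^ 2 ≠ 0 := pow_ne_zero 2 ht
    simp only [value_smul, hG t w ht, mul_eq_zero, ht2, false_or]
  rw [sum_filter_ne_zero_eq_lines _ hinv]
  congr 1
  simp only [one_pow, mul_one, mul_zero, sub_zero, zero_pow two_ne_zero, add_zero]
  by_cases ha : a = 0
  · have hb : b ≠ 0 := hab.resolve_left (not_not.2 ha)
    rw [if_pos ha, ha, if_pos (mul_zero δ₁)]
    congr 1
    have hx : ∀ x : k, (δ₁ * 0 * x ^ 2 + 2 * δ₁ * b * x - δ₂ * 0 = 0) ↔ x = 0 := fun x => by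
      constructor
      · intro h
        have h' : (2 * δ₁ * b) * x = 0 := by linear_combination h
        exact (mul_eq_zero.1 h').resolve_left (mul_ne_zero (mul_ne_zero (Ring.two_ne_zero hk) hδ₁) hb)
      · rintro rfl; ring
    simp_rw [hx, Finset.sum_ite_eq' univ (0 : k) (fun x => G (x, 1)), if_pos (Finset.mem_univ _)]
  · have hδa : δ₁ * a ≠ 0 := mul_ne_zero hδ₁ ha
    rw [if_neg ha, if_neg hδa, zero_add]
    have hiff : ∀ x : k, δ₁ * a * x ^ 2 + 2 * δ₁ * b * x - δ₂ * a = 0 ↔ (δ₁ * a * x + δ₁ * b) ^ 2 = δ₁ ^ 2 * b ^ 2 + δ₁ * δ₂ * a ^ 2 := fun x => by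
      constructor
      · intro h; linear_combination (δ₁ * a) * h
      · intro h
        have h' : δ₁ * a * (δ₁ * a * x ^ 2 + 2 * δ₁ * b * x - δ₂ * a) = 0 := by linear_combination h
        exact (mul_eq_zero.1 h').resolve_left hδa
    have hGx : ∀ x : k, G (x, 1) = G (δ₁ * a * x + δ₁ * b - δ₁ * b, δ₁ * a) := fun x => by
      have h := hG (δ₁ * a) (x, 1) hδa
      simp only [mul_one] at h
      rw [show δ₁ * a * x + δ₁ * b - δ₁ * b = δ₁ * a * x by ring]
      exact h.symm
    have hbij := affine_bijective hδa (δ₁ * b)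
    calc ∑ x : k, (if δ₁ * a * x ^ 2 + 2 * δ₁ * b * x - δ₂ * a = 0 then G (x, 1) else 0)
        = ∑ x : k, (fun u : k => if u ^ 2 = δ₁ ^ 2 * b ^ 2 + δ₁ * δ₂ * a ^ 2 then G (u - δ₁ * b, δ₁ * a) else 0) (δ₁ * a * x + δ₁ * b) := by
          refine Finset.sum_congr rfl fun x _ => ?_
          rw [hGx x]
          exact if_congr (hiff x) rfl rfl
      _ = ∑ u : k, (if u ^ 2 = δ₁ ^ 2 * b ^ 2 + δ₁ * δ₂ * a ^ 2 then G (u - δ₁ * b, δ₁ * a) else 0) :=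
          hbij.sum_comp (fun u : k => if u ^ 2 = δ₁ ^ 2 * b ^ 2 + δ₁ * δ₂ * a ^ 2 then G (u - δ₁ * b, δ₁ * a) else 0)
      _ = _ := by rw [← Finset.sum_filter]

/-- (I1) **THE NUMBER OF `S`-ISOTROPIC VECTORS: `#{w ≠ 0 : S(w) = 0} = (q − 1)·(1 − χ(δ₁δ₂))`** — two isotropic lines iff `χ(Δ) = χ(δ₁δ₂e) = +1` iff `χ(δ₁δ₂) = −1`
(`e` a non-square). [cite: LidlNiederreiter1996, Thm. 6.26–6.27] [cite: Kottwitz1986, §3] -/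
theorem sum_ite_value_eq_zero_one (hk : ringChar k ≠ 2) {δ₁ δ₂ : k} (hδ₁ : δ₁ ≠ 0) (hδ₂ : δ₂ ≠ 0) {a b b' : k} (hbb : δ₁ * b = δ₂ * b')
    (hirr : quadraticChar k (a ^ 2 + b * b') = -1) :
    ∑ w ∈ univ.filter (fun w : k × k => w ≠ 0), (if δ₁ * a * w.1 ^ 2 + 2 * δ₁ * b * w.1 * w.2 - δ₂ * a * w.2 ^ 2 = 0 then (1 : ℤ) else 0) =
      (Fintype.card k - 1) * (1 - quadraticChar k (δ₁ * δ₂)) := by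
  obtain ⟨-, ha0, -, hχΔ, -⟩ := irreducible_bookkeeping hδ₁ hδ₂ hbb hirr
  have hab : a ≠ 0 ∨ b ≠ 0 := by
    by_cases ha : a = 0
    · exact Or.inr (ha0 ha).1
    · exact Or.inl ha
  rw [sum_ite_value_eq_zero hk hδ₁ δ₂ hab (fun _ => (1 : ℤ)) (fun _ _ _ => rfl)]
  congr 1
  by_cases ha : a = 0
  · rw [if_pos ha, (ha0 ha).2]; norm_num
  · rw [if_neg ha, Finset.sum_const, nsmul_eq_mul, mul_one, card_filter_sq_eq hk, hχΔ]; ring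

/-- (I2) **THE NORM CHARACTERS OF THE `S`-ISOTROPIC VECTORS CANCEL: `Σ_{w ≠ 0, S(w) = 0} χ(m·n(w)) = 0`** (`m ≠ 0`).  If `a = 0` the two isotropic lines are the axes,
with `χ(mδ₁)·χ(mδ₂) = χ(δ₁δ₂) = −1`; if `a ≠ 0` and `Δ = r²`, the two isotropic lines `(±r − δ₁b, δ₁a)` have `n₊·n₋ = e·(2δ₁²δ₂a)²`, a NON-square times a square.
[cite: Rogawski1990, §4.9 Prop. 4.9.1 p. 55] [cite: Kottwitz1986, §3] [cite: LidlNiederreiter1996, Thm. 6.26–6.27] -/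
theorem sum_ite_value_eq_zero_quadraticChar_norm (hk : ringChar k ≠ 2) {δ₁ δ₂ : k} (hδ₁ : δ₁ ≠ 0) (hδ₂ : δ₂ ≠ 0) {a b b' : k} (hbb : δ₁ * b = δ₂ * b')
    (hirr : quadraticChar k (a ^ 2 + b * b') = -1) {m : k} (hm : m ≠ 0) :
    ∑ w ∈ univ.filter (fun w : k × k => w ≠ 0),
      (if δ₁ * a * w.1 ^ 2 + 2 * δ₁ * b * w.1 * w.2 - δ₂ * a * w.2 ^ 2 = 0 then quadraticChar k (m * (δ₁ * w.1 ^ 2 + δ₂ * w.2 ^ 2)) else 0) = 0 := by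
  obtain ⟨-, ha0, -, -, hΔ0⟩ := irreducible_bookkeeping hδ₁ hδ₂ hbb hirr
  have hab : a ≠ 0 ∨ b ≠ 0 := by
    by_cases ha : a = 0
    · exact Or.inr (ha0 ha).1
    · exact Or.inl ha
  rw [sum_ite_value_eq_zero hk hδ₁ δ₂ hab (fun w => quadraticChar k (m * (δ₁ * w.1 ^ 2 + δ₂ * w.2 ^ 2))) (fun t w ht => by
    simp only [norm_smul]; exact quadraticChar_mul_sq_mul m _ ht)]
  refine mul_eq_zero_of_right _ ?_
  by_cases ha : a = 0
  · rw [if_pos ha]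
    simp only [one_pow, mul_one, zero_pow two_ne_zero, mul_zero, add_zero, zero_add]
    refine quadraticChar_add_eq_zero_of_mul_eq_neg_one ?_
    rw [← map_mul, show m * δ₁ * (m * δ₂) = δ₁ * δ₂ * m ^ 2 by ring, map_mul, quadraticChar_sq_one' hm, mul_one]
    exact (ha0 ha).2
  · rw [if_neg ha]
    rcases quadraticChar_dichotomy hΔ0 with h1 | h1
    · -- `Δ` a non-zero square: two isotropic lines, with `n`-values of opposite character
      obtain ⟨r, hr⟩ := (quadraticChar_one_iff_isSquare hΔ0).1 h1
      have hr2 : δ₁ ^ 2 * b ^ 2 + δ₁ * δ₂ * a ^ 2 = r ^ 2 := by rw [hr, pow_two]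
      have hr0 : r ≠ 0 := fun h0 => hΔ0 (by rw [hr, h0, mul_zero])
      simp_rw [hr2]
      rw [filter_sq_eq_sq r, Finset.sum_pair (ne_neg_self_of_ne_zero hk hr0)]
      have hz : 2 * δ₁ ^ 2 * δ₂ * a * m ≠ 0 := mul_ne_zero (mul_ne_zero (mul_ne_zero (mul_ne_zero (Ring.two_ne_zero hk) (pow_ne_zero 2 hδ₁)) hδ₂) ha) hm
      have hprod : m * (δ₁ * (r - δ₁ * b) ^ 2 + δ₂ * (δ₁ * a) ^ 2) * (m * (δ₁ * (-r - δ₁ * b) ^ 2 + δ₂ * (δ₁ * a) ^ 2)) =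
          (a ^ 2 + b * b') * (2 * δ₁ ^ 2 * δ₂ * a * m) ^ 2 := by
        linear_combination (m ^ 2 * (δ₁ ^ 2 * (r ^ 2 + (δ₁ ^ 2 * b ^ 2 + δ₁ * δ₂ * a ^ 2)) - 2 * δ₁ ^ 4 * b ^ 2 + 2 * δ₁ ^ 3 * δ₂ * a ^ 2)) * hr2.symm +
          (4 * δ₁ ^ 4 * δ₂ * a ^ 2 * b * m ^ 2) * hbb
      have key : quadraticChar k (m * (δ₁ * (r - δ₁ * b) ^ 2 + δ₂ * (δ₁ * a) ^ 2)) * quadraticChar k (m * (δ₁ * (-r - δ₁ * b) ^ 2 + δ₂ * (δ₁ * a) ^ 2)) = -1 := by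
        rw [← map_mul, hprod, map_mul, hirr, quadraticChar_sq_one' hz, mul_one]
      exact quadraticChar_add_eq_zero_of_mul_eq_neg_one key
    · -- `Δ` a non-square: `S` is anisotropic
      rw [filter_sq_eq_empty_of_quadraticChar_eq_neg_one h1, Finset.sum_empty]

/-! ## §3 The three character sums over the whole plane -/

/-- (I3) **`Σ_{w ≠ 0} χ(m·n(w)) = 0`** for the non-degenerate root-plane norm `n = δ₁X² + δ₂Y²`: on the lines, `χ(mδ₁)·(1 + Σ_x χ(x² + δ₂∕δ₁)) = χ(mδ₁)·(1 − 1)`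
(Lidl–Niederreiter: `Σ_x χ(x² + t) = −1`, `t ≠ 0`). [cite: LidlNiederreiter1996, Thm. 5.48] [cite: IrelandRosen1990, Ch. 8 §2] -/
theorem sum_quadraticChar_norm_eq_zero (hk : ringChar k ≠ 2) {δ₁ δ₂ : k} (hδ₁ : δ₁ ≠ 0) (hδ₂ : δ₂ ≠ 0) (m : k) :
    ∑ w ∈ univ.filter (fun w : k × k => w ≠ 0), quadraticChar k (m * (δ₁ * w.1 ^ 2 + δ₂ * w.2 ^ 2)) = 0 := by
  by_cases hm : m = 0
  · simp [hm]
  rw [sum_filter_ne_zero_eq_lines (fun w : k × k => quadraticChar k (m * (δ₁ * w.1 ^ 2 + δ₂ * w.2 ^ 2))) (fun t w ht => by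
    simp only [norm_smul]; exact quadraticChar_mul_sq_mul m _ ht)]
  refine mul_eq_zero_of_right _ ?_
  simp only [one_pow, mul_one, zero_pow two_ne_zero, mul_zero, add_zero]
  have hx : ∀ x : k, quadraticChar k (m * (δ₁ * x ^ 2 + δ₂)) = quadraticChar k (m * δ₁) * quadraticChar k (x ^ 2 + δ₂ / δ₁) := fun x => by
    rw [← map_mul, show m * δ₁ * (x ^ 2 + δ₂ / δ₁) = m * (δ₁ * x ^ 2 + δ₂ / δ₁ * δ₁) by ring, div_mul_cancel₀ _ hδ₁]
  have hI : ∑ x : k, quadraticChar k (x ^ 2 + δ₂ / δ₁) = -1 := companionSum_two hk (div_ne_zero hδ₂ hδ₁)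
  simp_rw [hx]
  rw [← Finset.mul_sum, hI]
  ring

/-- (I4) **`Σ_{w ≠ 0} χ(c₀·S(w)) = 0`** for the non-degenerate cone value `S`: on the lines, `χ(c₀δ₁a) + Σ_x χ(c₀·S(x,1))` with `S(x,1) = ((δ₁(ax + b))² − Δ)∕(δ₁a)`, so the sum is
`χ(c₀δ₁a)·Σ_u χ(u² − Δ) = −χ(c₀δ₁a)` (`Δ ≠ 0`); if `a = 0`, `S(x,1) = 2δ₁bx` and `Σ_x χ(x) = 0`. [cite: LidlNiederreiter1996, Thm. 5.48] [cite: IrelandRosen1990, Ch. 8 §2] -/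
theorem sum_quadraticChar_value_eq_zero (hk : ringChar k ≠ 2) {δ₁ δ₂ : k} (hδ₁ : δ₁ ≠ 0) (hδ₂ : δ₂ ≠ 0) {a b b' : k} (hbb : δ₁ * b = δ₂ * b')
    (hirr : quadraticChar k (a ^ 2 + b * b') = -1) (c₀ : k) :
    ∑ w ∈ univ.filter (fun w : k × k => w ≠ 0), quadraticChar k (c₀ * (δ₁ * a * w.1 ^ 2 + 2 * δ₁ * b * w.1 * w.2 - δ₂ * a * w.2 ^ 2)) = 0 := by
  obtain ⟨-, -, -, -, hΔ0⟩ := irreducible_bookkeeping hδ₁ hδ₂ hbb hirr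
  rw [sum_filter_ne_zero_eq_lines (fun w : k × k => quadraticChar k (c₀ * (δ₁ * a * w.1 ^ 2 + 2 * δ₁ * b * w.1 * w.2 - δ₂ * a * w.2 ^ 2)))
    (fun t w ht => by simp only [value_smul]; exact quadraticChar_mul_sq_mul c₀ _ ht)]
  refine mul_eq_zero_of_right _ ?_
  simp only [one_pow, mul_one, zero_pow two_ne_zero, mul_zero, sub_zero, add_zero]
  by_cases ha : a = 0
  · rw [ha]
    simp only [mul_zero, zero_mul, zero_add, sub_zero, MulChar.map_zero]
    have hx : ∀ x : k, quadraticChar k (c₀ * (2 * δ₁ * b * x)) = quadraticChar k (c₀ * (2 * δ₁ * b)) * quadraticChar k x := fun x => by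
      rw [← map_mul]; congr 1; ring
    simp_rw [hx]
    rw [← Finset.mul_sum, quadraticChar_sum_zero hk, mul_zero]
  · have hδa : δ₁ * a ≠ 0 := mul_ne_zero hδ₁ ha
    have hx : ∀ x : k, quadraticChar k (c₀ * (δ₁ * a * x ^ 2 + 2 * δ₁ * b * x - δ₂ * a)) =
        quadraticChar k (c₀ * (δ₁ * a)) * quadraticChar k ((δ₁ * a * x + δ₁ * b) ^ 2 + -(δ₁ ^ 2 * b ^ 2 + δ₁ * δ₂ * a ^ 2)) := fun x => by
      rw [← map_mul, show c₀ * (δ₁ * a * x ^ 2 + 2 * δ₁ * b * x - δ₂ * a) =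
        c₀ * (δ₁ * a) * ((δ₁ * a * x + δ₁ * b) ^ 2 + -(δ₁ ^ 2 * b ^ 2 + δ₁ * δ₂ * a ^ 2)) * (δ₁ * a)⁻¹ ^ 2 by
          calc c₀ * (δ₁ * a * x ^ 2 + 2 * δ₁ * b * x - δ₂ * a)
              = c₀ * (δ₁ * a * x ^ 2 + 2 * δ₁ * b * x - δ₂ * a) * ((δ₁ * a) * (δ₁ * a)⁻¹) ^ 2 := by
                rw [mul_inv_cancel₀ hδa, one_pow, mul_one]
            _ = c₀ * (δ₁ * a) * ((δ₁ * a * x + δ₁ * b) ^ 2 + -(δ₁ ^ 2 * b ^ 2 + δ₁ * δ₂ * a ^ 2)) * (δ₁ * a)⁻¹ ^ 2 := by ring,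
        map_mul, map_pow, quadraticChar_sq_one (inv_ne_zero hδa), mul_one]
    have hI : ∑ u : k, quadraticChar k (u ^ 2 + -(δ₁ ^ 2 * b ^ 2 + δ₁ * δ₂ * a ^ 2)) = -1 := companionSum_two hk (neg_ne_zero.2 hΔ0)
    simp_rw [hx]
    rw [← Finset.mul_sum, (affine_bijective hδa (δ₁ * b)).sum_comp (fun u : k => quadraticChar k (u ^ 2 + -(δ₁ ^ 2 * b ^ 2 + δ₁ * δ₂ * a ^ 2))), hI]
    ring

/-- (I5) **THE JACOBSTHAL TERM: `Σ_{w ≠ 0} χ(c₀·S(w))·χ(−δ₀⁻¹·n(w)) = (q − 1)·χ(c₀δ₀δ₁δ₂)·J(e)`**, `J(e) = Σ_x χ(x)χ(x² − e)`, `e = a² + bb'`.  On the lines the summand is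
`χ(c₀δ₁)χ(−δ₀⁻¹δ₁)·χ((x² + d)(ax² + 2dyx − ad))` with `d = δ₂∕δ₁`, `y = b'` (and `χ(a)` on the line `(1,0)`), and the quartic-to-cubic transfer ★
`ConicTransfer.quadraticChar_quartic_transfer` turns `χ(a) + Σ_x χ((x² + d)(ax² + 2dyx − ad))` into `χ(−d)·J(a² + dy²) = χ(−d)·J(e)`.
[cite: Rogawski1990, §4.9 Prop. 4.9.1 p. 55] [cite: LidlNiederreiter1996, Def. 5.49, Thm. 6.26–6.27] [cite: IrelandRosen1990, Ch. 8 §3] -/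
theorem sum_quadraticChar_value_mul_quadraticChar_norm (hk : ringChar k ≠ 2) {δ₀ δ₁ δ₂ : k} (hδ₀ : δ₀ ≠ 0) (hδ₁ : δ₁ ≠ 0) (hδ₂ : δ₂ ≠ 0) {a b b' : k}
    (hbb : δ₁ * b = δ₂ * b') (hirr : quadraticChar k (a ^ 2 + b * b') = -1) (c₀ : k) :
    ∑ w ∈ univ.filter (fun w : k × k => w ≠ 0),
      quadraticChar k (c₀ * (δ₁ * a * w.1 ^ 2 + 2 * δ₁ * b * w.1 * w.2 - δ₂ * a * w.2 ^ 2)) * quadraticChar k (-δ₀⁻¹ * (δ₁ * w.1 ^ 2 + δ₂ * w.2 ^ 2)) =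
      (Fintype.card k - 1) * (quadraticChar k (c₀ * δ₀ * δ₁ * δ₂) * ∑ x : k, quadraticChar k x * quadraticChar k (x ^ 2 - (a ^ 2 + b * b'))) := by
  obtain ⟨he, -, -, -, -⟩ := irreducible_bookkeeping hδ₁ hδ₂ hbb hirr
  have hm : -δ₀⁻¹ ≠ 0 := neg_ne_zero.2 (inv_ne_zero hδ₀)
  rw [sum_filter_ne_zero_eq_lines (fun w : k × k => quadraticChar k (c₀ * (δ₁ * a * w.1 ^ 2 + 2 * δ₁ * b * w.1 * w.2 - δ₂ * a * w.2 ^ 2)) *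
      quadraticChar k (-δ₀⁻¹ * (δ₁ * w.1 ^ 2 + δ₂ * w.2 ^ 2))) (fun t w ht => by
    simp only [value_smul, norm_smul, quadraticChar_mul_sq_mul c₀ _ ht, quadraticChar_mul_sq_mul (-δ₀⁻¹) _ ht])]
  congr 1
  simp only [one_pow, mul_one, zero_pow two_ne_zero, mul_zero, sub_zero, add_zero]
  -- rewrite `b = δ₂b'/δ₁` and factor the constant `χ(c₀δ₁·(−δ₀⁻¹δ₁))`
  have hd : δ₂ / δ₁ ≠ 0 := div_ne_zero hδ₂ hδ₁
  have hb : b = δ₂ * b' / δ₁ := by rw [eq_div_iff hδ₁]; linear_combination hbb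
  have hdy : δ₂ / δ₁ * b' ^ 2 = b * b' := by rw [hb]; ring
  have he' : a ^ 2 + δ₂ / δ₁ * b' ^ 2 ≠ 0 := by rw [hdy]; exact he
  have h10 : quadraticChar k (c₀ * (δ₁ * a)) * quadraticChar k (-δ₀⁻¹ * δ₁) = quadraticChar k (c₀ * δ₁ * (-δ₀⁻¹ * δ₁)) * quadraticChar k a := by
    rw [← map_mul, ← map_mul]; congr 1; ring
  have hx : ∀ x : k, quadraticChar k (c₀ * (δ₁ * a * x ^ 2 + 2 * δ₁ * b * x - δ₂ * a)) * quadraticChar k (-δ₀⁻¹ * (δ₁ * x ^ 2 + δ₂)) =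
      quadraticChar k (c₀ * δ₁ * (-δ₀⁻¹ * δ₁)) * quadraticChar k ((x ^ 2 + δ₂ / δ₁) * (a * x ^ 2 + 2 * (δ₂ / δ₁) * b' * x - a * (δ₂ / δ₁))) := fun x => by
    rw [← map_mul, ← map_mul]; congr 1; rw [hb]; field_simp
  rw [h10]
  simp_rw [hx]
  rw [← Finset.mul_sum, ← mul_add, quadraticChar_quartic_transfer hk hd a b' he', ← mul_assoc, ← map_mul, hdy]
  congr 1
  rw [show c₀ * δ₁ * (-δ₀⁻¹ * δ₁) * -(δ₂ / δ₁) = c₀ * δ₀ * δ₁ * δ₂ * δ₀⁻¹ ^ 2 by field_simp, map_mul, map_pow, quadraticChar_sq_one (inv_ne_zero hδ₀), mul_one]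

end Literature.NumberTheory.Rogawski1990.TypeTwoBlockRoot
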